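import Summits.ResolutionOfSingularities.ResolutionOfSingularities.Theorems.FrobeniusLadderFInjectiveMacaulayficationSemiLocalScheme
import Summits.ResolutionOfSingularities.ResolutionOfSingularities.Theorems.FrobeniusLadderFInjectiveMacaulayficationSemiLocalBlowupChart
import Summits.ResolutionOfSingularities.ResolutionOfSingularities.Theorems.FrobeniusLadderFInjectiveMacaulayficationDominatingLocFixLocal
import Literature.AlgebraicGeometry.Resolution.BlowupChartTransition
import HarnessLib

/-!
# The SEMI-LOCAL product-compatible regular blow-up, READ AT EACH POINT: one ideal `𝔮₀ ⊆ R` whose charts `R_p[(𝔧𝔮₀)/d_j]` are regular at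
# every prime, simultaneously for all `p` in a finite set `P` of points of local dimension three
# (crux `FInjectiveMacaulayfication` stmt-ResolutionOfSingularities-15315, chain w45a; res-L1-w45a-plan-1 R16.54 (2)/R16.56 — input of
# res-L1-w45a-stub-1's `clusterGrowth_multi`; seat res-L1-w45a-stub-3 g7)

[OURS · L1 W4.5a] Support file (`--supports stmt-ResolutionOfSingularities-15315 --as helper`); NOT a statement of any manuscript; def-free;
THEOREMS modulo three printed results BY NAME (`CossartPiltant2019General` = CP 2019 Thm. 1.1 (i)(ii), `Stacks081R` = Raynaud–Gruson
5.2.2, `CossartPiltant2019Principalization` = CP 2019 Prop. 4.4); AI-written (AI review is weaker than expert review).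

* §1 **`exists_regularChartData_of_dim_three (hG h081R hP) (S) (hqe) (hdim : ringKrullDim S = 3) (𝔞 ≠ ⊥)`** — the (b2) statement of
  `DominatingLocFixLocal.exists_productCompatible_locFix_dimThree` for an ABSTRACT Noetherian quasi-excellent domain `S` of dimension `3`
  (there: `S = 𝒪_{X₁,ζ}`): an ideal `𝔮 ≠ ⊥` and generators `d` of `𝔞 · 𝔮` all of whose affine blow-up charts `S[(d)/d_j]` are REGULAR at every
  prime. Proof = the (b2) proof verbatim ((b1) on `Spec S`, then chart primes are points of `Bl_{(d)} Spec S`).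
* §2 **`exists_regularChartData_semiLocal`** — `R` a Noetherian quasi-excellent domain, `P` a finite set of primes with `dim R_p ≤ 3`, one `= 3`,
  `𝔧 ≠ ⊥`: ONE ideal `𝔮₀ ≠ ⊥` of `R` such that for EVERY `p ∈ P` and EVERY local ring `T` of `R` at `p` (`[IsLocalization.AtPrime T p]`, e.g.
  the stalk of an affine scheme), `(𝔧 · 𝔮₀)T` has generators `d` with all charts `T[(d)/d_j]` regular at every prime — §1 over the semi-local
  ring (`SemiLocalScheme`), `𝔮₀ :=` the contraction of `𝔮`, and the descent of chart regularity to the localisation `T` of the semi-local ring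
  (`SemiLocalBlowupChart`). `…_of_finiteType` discharges quasi-excellence over a field.
[cite: CossartPiltant2019, Thm. 1.1 (i)(ii); Prop. 4.4] [cite: RaynaudGruson1971, Thm. 5.2.2] [cite: StacksProject, Tag 0804; Tag 052Q]
-/

-- single-problem summit: the doubled namespace component is forced
set_option linter.dupNamespace false

noncomputable section

universe u

namespace Summit.ResolutionOfSingularities.ResolutionOfSingularities.Theorems.FInjectiveMacaulayfication.SemiLocalLocFix

open CategoryTheory CategoryTheory.Limits AlgebraicGeometry TopologicalSpace IsLocalRing
open Literature.AlgebraicGeometry.Resolution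
open Summit.ResolutionOfSingularities.ResolutionOfSingularities.Theorems.FInjectiveMacaulayfication
open SliceableCentre FCUnguardedAprime

/-! ## §1 (b2) over an abstract three-dimensional quasi-excellent domain -/

-- adapted from `DominatingLocFixLocal.exists_productCompatible_locFix_dimThree` (res-L1-w45a-stub-1), stalk replaced by an abstract `S`
set_option maxHeartbeats 800000 in
-- instance unification on the Rees chart ring `chartRing d j` is slow (as in `BlowupAlgebraPrimesPoints.lean`)
/-- **Regular product-compatible chart data over an abstract quasi-excellent domain of dimension three.** For `S` a Noetherian
quasi-excellent domain with `dim S = 3` and `𝔞 ≠ ⊥` there are an ideal `𝔮 ≠ ⊥` and generators `d` of `𝔞 · 𝔮` such that every local ring of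
every affine blow-up chart `S[(d)/d_j]` is REGULAR — modulo CP 2019 Thm. 1.1, Raynaud–Gruson flattening and CP 2019 Prop. 4.4 BY NAME.
[OURS · conditional-result] [cite: CossartPiltant2019, Thm. 1.1 (i)(ii); Prop. 4.4] [cite: StacksProject, Tag 0804] -/
theorem exists_regularChartData_of_dim_three
    (hG : CossartPiltant2019General.{u}) (h081R : Stacks081R.{u}) (hP : CossartPiltant2019Principalization.{u})
    (S : Type u) [CommRing S] [IsDomain S] [IsNoetherianRing S] (hqe : IsQuasiExcellentRing S) (hdim : ringKrullDim S = 3)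
    (𝔞 : Ideal S) (h𝔞 : 𝔞 ≠ ⊥) :
    ∃ 𝔮 : Ideal S, 𝔮 ≠ ⊥ ∧ ∃ (n : ℕ) (d : Fin n → S), Ideal.span (Set.range d) = 𝔞 * 𝔮 ∧
      ∀ (j : Fin n) (𝔔 : PrimeSpectrum (blowupAlgebra (Ideal.span (Set.range d)) (d j))),
        IsRegularLocalRing (Localization.AtPrime 𝔔.asIdeal) := by
  classical
  haveI : IsNoetherianRing (CommRingCat.of S) := ‹IsNoetherianRing S›
  haveI : IsDomain (CommRingCat.of S) := ‹IsDomain S›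
  have hqe' : Scheme.IsQuasiExcellent (Spec (.of S)) :=
    Scheme.isQuasiExcellent_of_locallyOfFiniteType_of_isQuasiExcellentRing Stacks07QU_holds hqe (𝟙 _)
  have hdimS : topologicalKrullDim (Spec (.of S)) = 3 := by
    change topologicalKrullDim (PrimeSpectrum S) = 3
    rw [PrimeSpectrum.topologicalKrullDim_eq_ringKrullDim, hdim]
  -- the scheme-level product-compatible resolution applied to `𝔞~`
  obtain ⟨𝔟, h𝔟, -, hall⟩ := DominatingLocFixRegular.exists_isBlowup_mul_isRegular_of_dim_three hG h081R hP hqe' hdimS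
    (affineBlowup.idealSheaf 𝔞) (affineBlowup.idealSheaf_ne_bot h𝔞)
  -- `𝔟 = 𝔮~` for the ideal `𝔮` of `S` of its global sections
  let eΓ := Scheme.ΓSpecIso (.of S)
  let 𝔮 : Ideal S := (𝔟.ideal ⟨⊤, isAffineOpen_top _⟩).map eΓ.hom.hom
  have hcomp : eΓ.inv.hom.comp eΓ.hom.hom = RingHom.id _ := by
    rw [← CommRingCat.hom_comp, Iso.hom_inv_id, CommRingCat.hom_id]
  have h𝔮map : 𝔮.map eΓ.inv.hom = 𝔟.ideal ⟨⊤, isAffineOpen_top _⟩ := by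
    rw [Ideal.map_map, hcomp, Ideal.map_id]
  have h𝔟eq : affineBlowup.idealSheaf 𝔮 = 𝔟 := by
    apply Scheme.IdealSheafData.ext_of_isAffine
    rw [affineBlowup.idealSheaf, ideal_ofIdealTop_top, h𝔮map]
  have h𝔮0 : 𝔮 ≠ ⊥ := by
    intro h0
    apply h𝔟
    rw [← h𝔟eq, h0]
    apply Scheme.IdealSheafData.ext_of_isAffine
    rw [affineBlowup.idealSheaf, ideal_ofIdealTop_top, Ideal.map_bot, Scheme.IdealSheafData.ideal_bot, Pi.bot_apply]
  have hprod : affineBlowup.idealSheaf 𝔞 * 𝔟 = affineBlowup.idealSheaf (𝔞 * 𝔮) := by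
    rw [affineBlowup.idealSheaf_mul, h𝔟eq]
  -- generators `d` of `𝔞 · 𝔮`
  obtain ⟨n, d, hd⟩ := Submodule.fg_iff_exists_fin_generating_family.mp (IsNoetherian.noetherian (𝔞 * 𝔮))
  have hd' : Ideal.span (Set.range d) = 𝔞 * 𝔮 := hd
  -- the affine blowing up `Bl_{(d)} Spec S` is a blowing up along `𝔞~ · 𝔟`, hence regular
  have hreg : Scheme.IsRegular (affineBlowup (Ideal.span (Set.range d))) := by
    refine hall _ (affineBlowup.π (Ideal.span (Set.range d))) ?_
    rw [hprod, ← hd']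
    exact affineBlowup.isBlowup _
  refine ⟨𝔮, h𝔮0, n, d, hd', fun j 𝔔 => ?_⟩
  -- the prime `𝔔` of the chart `S[(d)/d_j]` is a point `x′` of the chart `Spec (S[(d)t])_{(d_j t)} ⊆ Bl_{(d)} Spec S`
  have hdj : ∀ j, d j ∈ Ideal.span (Set.range d) := fun j => Ideal.mem_span_range_self (f := d) (x := j)
  set ε : chartRing d j ≃+* blowupAlgebra (Ideal.span (Set.range d)) (d j) :=
    reesChartEquiv (I := Ideal.span (Set.range d)) (d j) (hdj j) with hεdef
  let w : Spec (.of (chartRing d j)) :=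
    ⟨𝔔.asIdeal.comap (ε : chartRing d j →+* _), Ideal.comap_isPrime (ε : chartRing d j →+* _) 𝔔.asIdeal⟩
  have hmemw : ∀ b : chartRing d j, ε b ∈ 𝔔.asIdeal ↔ b ∈ w.asIdeal := fun b => Iff.rfl
  haveI : IsIso ((affineBlowup.chartι (I := Ideal.span (Set.range d)) (d j) (hdj j)).stalkMap w) := inferInstance
  haveI := w.2
  haveI := 𝔔.2
  obtain ⟨e3⟩ := BlowupFiModelOfCover.nonempty_ringEquiv_localization_of_ringEquiv ε w.asIdeal 𝔔.asIdeal hmemw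
  have e : (affineBlowup (Ideal.span (Set.range d))).presheaf.stalk
      ((affineBlowup.chartι (I := Ideal.span (Set.range d)) (d j) (hdj j)) w) ≃+* Localization.AtPrime 𝔔.asIdeal :=
    ((asIso ((affineBlowup.chartι (I := Ideal.span (Set.range d)) (d j) (hdj j)).stalkMap w)).commRingCatIsoToRingEquiv.trans
      (Spec.stalkIso (.of (chartRing d j)) w).commRingCatIsoToRingEquiv).trans e3
  have hregx : IsRegularLocalRing ((affineBlowup (Ideal.span (Set.range d))).presheaf.stalk
      ((affineBlowup.chartι (I := Ideal.span (Set.range d)) (d j) (hdj j)) w)) := hreg _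
  haveI := hregx
  exact IsRegularLocalRing.of_ringEquiv e

/-! ## §2 The semi-local version, read at each prime of `P` -/

/-- **ONE cure for finitely many points, read locally.** `R` a Noetherian quasi-excellent domain, `P` a finite set of primes with
`dim R_p ≤ 3` for all and `= 3` for at least one `p ∈ P` (MIXED local dimensions allowed), `𝔧 ≠ ⊥` an ideal of `R`. There is ONE ideal `𝔮₀ ≠ ⊥` of `R` such that for every `p ∈ P` and every local ring `T` of
`R` at `p`, the ideal `(𝔧 · 𝔮₀)T` has generators `d` all of whose affine blow-up charts `T[(d)/d_j]` are REGULAR at every prime.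
(§1 over the semi-local ring of `R` at `P`; `𝔮₀` = the contraction of its `𝔮`; chart regularity descends to the localisation `T` of the
semi-local ring.) Modulo CP 2019 Thm. 1.1, Raynaud–Gruson and CP 2019 Prop. 4.4 BY NAME. [OURS · conditional-result]
[cite: CossartPiltant2019, Thm. 1.1 (i)(ii); Prop. 4.4] [cite: StacksProject, Tag 0804; Tag 052Q] -/
theorem exists_regularChartData_semiLocal
    (hG : CossartPiltant2019General.{u}) (h081R : Stacks081R.{u}) (hP : CossartPiltant2019Principalization.{u})
    {R : Type u} [CommRing R] [IsDomain R] [IsNoetherianRing R] (hR : IsQuasiExcellentRing R)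
    (P : Finset (PrimeSpectrum R)) (hle : ∀ p ∈ P, ringKrullDim (Localization.AtPrime p.asIdeal) ≤ 3)
    (h3 : ∃ p ∈ P, ringKrullDim (Localization.AtPrime p.asIdeal) = 3) (𝔧 : Ideal R) (h𝔧 : 𝔧 ≠ ⊥) :
    ∃ 𝔮₀ : Ideal R, 𝔮₀ ≠ ⊥ ∧ ∀ p ∈ P, ∀ (T : Type u) [CommRing T] [Algebra R T] [IsLocalization.AtPrime T p.asIdeal],
      ∃ (n : ℕ) (d : Fin n → T), Ideal.span (Set.range d) = (𝔧 * 𝔮₀).map (algebraMap R T) ∧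
        ∀ (j : Fin n) (𝔔 : PrimeSpectrum (blowupAlgebra (Ideal.span (Set.range d)) (d j))),
          IsRegularLocalRing (Localization.AtPrime 𝔔.asIdeal) := by
  classical
  obtain ⟨p₃, hp₃, hp₃3⟩ := h3
  have hPn : P.Nonempty := ⟨p₃, hp₃⟩
  -- the semi-local ring `S` of `R` at `P`: a Noetherian quasi-excellent domain of dimension `max_p dim R_p = 3`
  let S : Type u := Localization (⨅ p ∈ P, p.asIdeal.primeCompl : Submonoid R)
  have hM := SemiLocalScheme.iInf_primeCompl_le_nonZeroDivisors P hPn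
  haveI : IsDomain S := SemiLocalScheme.isDomain P S hPn
  haveI : IsNoetherianRing S := IsLocalization.isNoetherianRing (⨅ p ∈ P, p.asIdeal.primeCompl : Submonoid R) S inferInstance
  have hqeS : IsQuasiExcellentRing S := SemiLocalScheme.isQuasiExcellentRing P S hR
  have e3 : ((3 : ℕ) : WithBot ℕ∞) = 3 := rfl
  have hdimS : ringKrullDim S = 3 := by
    apply le_antisymm
    · have h := SemiLocalScheme.ringKrullDim_le_of_forall P S 3 (fun p hp => by rw [e3]; exact hle p hp)
      rwa [e3] at h
    · rw [← hp₃3]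
      exact SemiLocalScheme.le_ringKrullDim_of_mem P S hp₃
  -- `𝔧S ≠ ⊥`
  have h𝔞 : 𝔧.map (algebraMap R S) ≠ ⊥ := by
    obtain ⟨x, hx, hx0⟩ := Submodule.exists_mem_ne_zero_of_ne_bot h𝔧
    intro h
    have hx' : algebraMap R S x ∈ (⊥ : Ideal S) := h ▸ Ideal.mem_map_of_mem _ hx
    rw [Ideal.mem_bot, ← map_zero (algebraMap R S)] at hx'
    exact hx0 (IsLocalization.injective S hM hx')
  obtain ⟨𝔮, h𝔮0, n, d, hd, hreg⟩ := exists_regularChartData_of_dim_three hG h081R hP S hqeS hdimS _ h𝔞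
  have h𝔮 : (𝔮.comap (algebraMap R S)).map (algebraMap R S) = 𝔮 :=
    IsLocalization.map_under (⨅ p ∈ P, p.asIdeal.primeCompl : Submonoid R) S 𝔮
  refine ⟨𝔮.comap (algebraMap R S), fun h0 => h𝔮0 (by rw [← h𝔮, h0, Ideal.map_bot]), fun p hp T _ _ _ => ?_⟩
  -- `T` is an `S`-algebra (the localisation of `S` at the image of `p.primeCompl`)
  have hunits : ∀ y : (⨅ p ∈ P, p.asIdeal.primeCompl : Submonoid R), IsUnit (algebraMap R T y) := fun y =>
    IsLocalization.map_units T ⟨y.1, SemiLocalScheme.iInf_primeCompl_le P hp y.2⟩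
  letI : Algebra S T := (IsLocalization.lift (M := (⨅ p ∈ P, p.asIdeal.primeCompl : Submonoid R)) (S := S) hunits).toAlgebra
  haveI : IsScalarTower R S T := IsScalarTower.of_algebraMap_eq fun r =>
    (IsLocalization.lift_eq (M := (⨅ p ∈ P, p.asIdeal.primeCompl : Submonoid R)) (S := S) hunits r).symm
  haveI : IsLocalization ((p.asIdeal.primeCompl).map (algebraMap R S)) T := SemiLocalScheme.isLocalization_map_primeCompl P S hp T
  have hdj : ∀ j, d j ∈ Ideal.span (Set.range d) := fun j => Ideal.mem_span_range_self (f := d) (x := j)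
  refine ⟨n, fun j => algebraMap S T (d j), ?_, fun j => ?_⟩
  · show Ideal.span (Set.range (⇑(algebraMap S T) ∘ d)) = _
    rw [Set.range_comp, ← Ideal.map_span, hd, Ideal.map_mul, Ideal.map_mul, IsScalarTower.algebraMap_eq R S T, ← Ideal.map_map,
      ← Ideal.map_map, h𝔮]
  · have hX : (Ideal.span (Set.range d)).map (algebraMap S T) = Ideal.span (Set.range fun j => algebraMap S T (d j)) := by
      rw [Ideal.map_span, ← Set.range_comp]
      rfl
    haveI : IsNoetherianRing (blowupAlgebra (Ideal.span (Set.range d)) (d j)) := isNoetherianRing_blowupAlgebra_of_isNoetherianRing _ _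
    have key := SemiLocalBlowupChart.isRegularLocalRing_localization_blowupAlgebra_map (B := T) ((p.asIdeal.primeCompl).map (algebraMap R S))
      (Ideal.span (Set.range d)) (d j) (hdj j) (hreg j)
    show ∀ 𝔔 : PrimeSpectrum (blowupAlgebra (Ideal.span (Set.range fun j => algebraMap S T (d j))) (algebraMap S T (d j))),
      IsRegularLocalRing (Localization.AtPrime 𝔔.asIdeal)
    rw [← hX]
    exact key

/-- The same for a finite type domain over a field (quasi-excellence discharged; Noetherian by Hilbert). [OURS · conditional-result]
[cite: CossartPiltant2019, Thm. 1.1 (i)(ii); Prop. 4.4] [cite: StacksProject, Tag 07QW] -/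
theorem exists_regularChartData_semiLocal_of_finiteType
    (hG : CossartPiltant2019General.{u}) (h081R : Stacks081R.{u}) (hP : CossartPiltant2019Principalization.{u})
    (k : Type u) [Field k] {R : Type u} [CommRing R] [IsDomain R] [Algebra k R] [Algebra.FiniteType k R]
    (P : Finset (PrimeSpectrum R)) (hle : ∀ p ∈ P, ringKrullDim (Localization.AtPrime p.asIdeal) ≤ 3)
    (h3 : ∃ p ∈ P, ringKrullDim (Localization.AtPrime p.asIdeal) = 3) (𝔧 : Ideal R) (h𝔧 : 𝔧 ≠ ⊥) :
    ∃ 𝔮₀ : Ideal R, 𝔮₀ ≠ ⊥ ∧ ∀ p ∈ P, ∀ (T : Type u) [CommRing T] [Algebra R T] [IsLocalization.AtPrime T p.asIdeal],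
      ∃ (n : ℕ) (d : Fin n → T), Ideal.span (Set.range d) = (𝔧 * 𝔮₀).map (algebraMap R T) ∧
        ∀ (j : Fin n) (𝔔 : PrimeSpectrum (blowupAlgebra (Ideal.span (Set.range d)) (d j))),
          IsRegularLocalRing (Localization.AtPrime 𝔔.asIdeal) := by
  haveI : IsNoetherianRing R := Algebra.FiniteType.isNoetherianRing k R
  exact exists_regularChartData_semiLocal hG h081R hP (isQuasiExcellentRing_of_finiteType_field k R) P hle h3 𝔧 h𝔧

end Summit.ResolutionOfSingularities.ResolutionOfSingularities.Theorems.FInjectiveMacaulayfication.SemiLocalLocFix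

end
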